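import Mathlib
import Literature.Probability.Percolation.ZdFiveArmMonotone
import Literature.Probability.Percolation.FourArmGarbanProofs
import HarnessLib

/-!
# ZdFiveArmUpperBound

Topic `Literature/Probability/Percolation`. Named literature fact(s) relocated by the gate from `Summits/CriticalPhenomena/CardyFormulaZ2/Theorems/CardyMagicRigidityNestingRigidityFiveArmUpperZ2.lean`
(accept-time relocation of `[cite]`d propositions written inline in a Summits proposal; human ruling 2026-08-15).
Sources: ChelkakDuminilCopinHongler2016, DuminilCopinManolescuTassion2021, KestenSidoraviciusZhang1998, Nolin2008.

* `Literature.Probability.Percolation.DuminilCopinManolescuTassion2021_zdFiveArm_upperBound`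
-/

namespace Literature.Probability.Percolation

open MeasureTheory Literature.Probability.Percolation Literature.Probability.LatticeModels

/-- **The five-arm exponent of critical bond percolation on `ℤ²` is at least `2`, two radii (universal arm
exponent; Duminil-Copin–Manolescu–Tassion 2021, Prop. 6.6, upper bound, `q = 1`).**  H. Duminil-Copin,
I. Manolescu, V. Tassion, *Planar random-cluster model: fractal properties of the critical phase*, Probab. Theory
Related Fields 181 (2021) 401–449 (arXiv 2007.14707), §6.3, Prop. 6.6 (Universal arm-exponents), verbatim:
"Let `1 ≤ q < 4`. There exist `c₉, C₉ > 0` such that for every `R ≥ r ≥ 1`,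
`c₉ (r/R)² ≤ φ_{ℤ²}[A_{10101}(r,R)] ≤ C₉ (r/R)²`, `c₉ (r/R)² ≤ φ_{ℤ²}[A⁺_{101}(r,R)] ≤ C₉ (r/R)²`,
`c₉ r/R ≤ φ_{ℤ²}[A⁺_{10}(r,R)] ≤ C₉ r/R`."  Setting (ibid. §1.2, §6): `Λ_n` is "the domain spanned by the vertex-set
`{-n,…,n}²`" of the square lattice; `φ_{ℤ²}` is the unique infinite-volume random-cluster measure at `p = p_c(q) =
√q/(1+√q)`, and "when `q = 1`, `φ` is a product measure …; this model is also called Bernoulli percolation with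
parameter `p`", so at `q = 1` it is bond percolation on `ℤ²` at `p_c(1) = 1/2`, the tree's
`bondPercolation (zdGraph 2) half`; "a self-avoiding path of `ℤ²` or `(ℤ²)*` connecting the inner to the outer
boundaries of the annulus [`Λ_R ∖ Λ_r`] is called an arm … of type `1` if it is composed of primal edges that are
all open, and of type `0` if it is composed of dual edges that are all dual-open.  For `k ≥ 1` and `σ ∈ {0,1}^k`,
define `A_σ(r,R)` to be the event that there exist `k` disjoint arms from `∂Λ_r` to `∂Λ_R` which are of type
`σ₁,…,σ_k`, when indexed in counterclockwise order."  VENDORED HERE: only the first upper inequality (five arms,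
`σ = 10101`: open, dual, open, dual, open in cyclic order) at `q = 1`.
PROOF IN PRINT: "The proof of [CheDumHon13] extends trivially to our setting using [quasi-multiplicativity,
Prop. 6.3] and Proposition [6.5, localization]"; D. Chelkak, H. Duminil-Copin, C. Hongler, EJP 21 (2016), Cor. 1.5
(`φ[A_{10110}(n,N)] ≍ (n/N)²`) with proof in §5.2: by quasi-multiplicativity it suffices to treat `(0,N)`; for the
upper bound one localizes the landing arcs (Cor. 1.4) and counts the events `A_x`, `x ∈ Λ_{N/2}`, of "five mutually
edge-avoiding arms `γ₁,…,γ₅` of respective types `10110`" with prescribed landing sides: "`N² φ[A_{10110}(0,N)] ≍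
Σ_{x ∈ Λ_{N/2}} φ[A_x] ≤ 1` … the events `A_x` are disjoint (topologically no two vertices in `Λ_N` can satisfy the
events in question)".  Earlier sources of the same theorem: H. Kesten, V. Sidoravicius, Y. Zhang, EJP 3 (1998),
Lemma 5, (3.7)–(3.8) (site percolation on `𝕋`, where all non-constant colourings are comparable; two radii: "for
`1 ≤ k ≤ n`, `P{there exists 5 disjoint paths from Δ(v + S(k)) to Δ(v + S(n)), one of which is vacant and the other
four of which are occupied} ≤ c₁₆ k²/n²`", proved through the three-occupied/two-vacant event `F(w,n)`);
P. Nolin, EJP 13 (2008), §5.2 Thm. 24 (ii) [arXiv 0711.4948: Thm. 23] with Rem. 25: "these estimates for critical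
and near-critical percolation remain valid on other lattices too, like the square lattice … at least for the color
sequences that we have used in the proofs" (`σ₅ = BWBBW`, i.e. `10101` up to rotation), and
§8.1: "We can also handle bond percolation in this way"; W. Werner, PCMI 16 (2009), first exercise sheet,
"Five-arm exponent" (separation-free counting via `E[K²] < ∞`).
RENDERING (the standard dictionary between arm events and clusters on the self-dual square lattice, as for
`Garban2011_fourArm_multiscale` and in the docstring of `zdFiveArmClusters`, which cites van den Berg–Nolin 2020 §1
and Nolin 2008 §4.1 for exactly this event): `A_{10101}(r,R)` is read as `zdFiveArmClusters r R` — three open lattice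
walks `W₁ = γ₁`, `W₂ = γ₃`, `W₃ = γ₅` of the annulus `sqAnnulus r R = {r ≤ ‖·‖_∞ ≤ R}` from `‖·‖_∞ = r` to
`‖·‖_∞ = R`; the two dual-open arms `γ₂, γ₄` flanking `γ₃` are recorded duality-free as "the inner ends of `W₁, W₂`
are not joined by an open path of the annulus" (two distinct open annulus-clusters ⟺ two separating dual-open arms,
Kesten 1982 §2); the disjointness of the two cyclically adjacent open arms `γ₅, γ₁` is edge-disjointness ("mutually
edge-avoiding arms", the form in which the counting argument of the printed proof is run).  The constant depends on
nothing; the inner radius starts at `r = 1` (`siteSphere 1` = the eight neighbours of the origin in sup-norm).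
NOT vendored: the matching lower bound `c₉ (r/R)² ≤ …` (the missing input of the tree's
`fourArm_lowerBound_of_fiveArm_oneArm`), the two half-plane items, `q > 1`.
[cite: DuminilCopinManolescuTassion2021, §6.3 Prop. 6.6 (universal arm exponents), first display, upper bound, q = 1 (arXiv 2007.14707 numbering)]
[cite: ChelkakDuminilCopinHongler2016, Cor. 1.5 and §5.2, proof of Cor. 1.5 (arXiv 1312.7785 numbering)]
[cite: Nolin2008, §5.2 Thm. 24 (ii) and Rem. 25, §8.1 (arXiv 0711.4948: Thm. 23, Rem. 25)]
[cite: KestenSidoraviciusZhang1998, Lemma 5, (3.7)-(3.8)]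
[file Probability/Percolation/ZdFiveArmUpperBound] -/
def DuminilCopinManolescuTassion2021_zdFiveArm_upperBound : Prop :=
  ∃ C : ℝ, 0 < C ∧ ∀ r R : ℕ, 1 ≤ r → r ≤ R →
    (Literature.Probability.Percolation.bondPercolation (Literature.Probability.LatticeModels.zdGraph 2)
        Literature.Probability.Percolation.half).real
      (Literature.Probability.Percolation.zdFiveArmClusters r R) ≤ C * ((r : ℝ) / R) ^ 2

/-! ### The stub from the printed shape, and back -/

/-! ### The printed route to two radii: point bound, quasi-multiplicativity, point lower bound

The printed proof of Prop. 6.6 (DMT 2021: "The proof of [CheDumHon13] extends trivially to our setting using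
(quasi-multiplicativity, Prop. 6.3) and Proposition 6.5 (localization)"; Chelkak–Duminil-Copin–Hongler 2016, §5.2:
"By quasi-multiplicativity, we only need to show that `φ[A_{10110}(0,N)] ≍ N⁻²`"; Kesten–Sidoravicius–Zhang 1998,
proof of Lemma 5: "(3.8) can be deduced [from (3.7)] by the method of Lemma 6 in Kesten (1987)") has three inputs,
rendered here for the tree's cluster-form event `zdFiveArmClusters` at a fixed inner radius `m₁ ≥ 1`:
(U) the POINT upper bound `P(𝒜₅(A_{m₁,n})) ≤ C n⁻²` (KSZ (3.7), upper half; CDH §5.2, uniqueness of the five-arm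
vertex with prescribed landing sides), (Q) the GLUING half of quasi-multiplicativity at the inner scale
`c · P(𝒜₅(A_{m₁,m})) · P(𝒜₅(A_{m,n})) ≤ P(𝒜₅(A_{m₁,n}))` (DMT Prop. 6.3, right inequality; Nolin 2008 Prop. 17;
Kesten 1987 Lemma 6 — Kesten's arm separation at the inner boundary), and (L) the POINT lower bound
`c' m⁻² ≤ P(𝒜₅(A_{m₁,m}))` (KSZ (3.7), lower half; Nolin 2008 Thm. 24 (ii), lowest-crossing construction).  The
theorem below is the bookkeeping `(U) ∧ (Q) ∧ (L) ⇒` the named fact, including the small radii `r < m₁` (monotonicity of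
the five-arm event in the radii, `real_zdFiveArmClusters_mono`) and `R < m₁` (a probability is at most `1`); it asserts
none of (U), (Q), (L). -/

/-- **Two radii from one radius** (the printed architecture of DMT 2021 Prop. 6.6 / CDH 2016 Cor. 1.5 / KSZ 1998
Lemma 5, (3.7) ⇒ (3.8)).  Fix an inner radius `m₁ ≥ 1`.  If
(U) `P_{1/2}(𝒜₅(A_{m₁,n})) ≤ C / n²` for all `n ≥ m₁`,
(Q) `c · P(𝒜₅(A_{m₁,m})) · P(𝒜₅(A_{m,n})) ≤ P(𝒜₅(A_{m₁,n}))` for `m₁ ≤ m ≤ n`, some `c > 0`, and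
(L) `c' / m² ≤ P_{1/2}(𝒜₅(A_{m₁,m}))` for all `m ≥ m₁`, some `c' > 0`,
then `DuminilCopinManolescuTassion2021_zdFiveArm_upperBound` holds, with the constant
`(max C 0 / (c c') + 1) · m₁²`: for `m₁ ≤ r ≤ R`, `P(𝒜₅(A_{r,R})) ≤ P(𝒜₅(A_{m₁,R})) / (c P(𝒜₅(A_{m₁,r}))) ≤
(C/R²)/(c c'/r²)`; for `r < m₁ ≤ R`, `P(𝒜₅(A_{r,R})) ≤ P(𝒜₅(A_{m₁,R})) ≤ (max C 0/(c c')) (m₁/R)² ≤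
(max C 0/(c c')) m₁² (r/R)²`; for `R < m₁`, `P ≤ 1 ≤ m₁² (r/R)²`.  Nothing printed is asserted: (U), (Q), (L) are
hypotheses (for bond percolation on `ℤ²`, (Q) and the localization behind (U) rest on Kesten's arm-separation
theory, Kesten 1987 Lemmas 4–6, which the tree does not have for the square lattice).
[cite: DuminilCopinManolescuTassion2021, §6.3, proof of Prop. 6.6 (via Prop. 6.3 and Prop. 6.5)] [cite: ChelkakDuminilCopinHongler2016, §5.2, proof of Cor. 1.5, first sentence] [cite: KestenSidoraviciusZhang1998, proof of Lemma 5, deduction of (3.8) from (3.7)] -/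
theorem DuminilCopinManolescuTassion2021_zdFiveArm_upperBound_of_pointBound_quasiMult {m₁ : ℕ} (hm₁ : 1 ≤ m₁)
    (hU : ∃ C : ℝ, ∀ n : ℕ, m₁ ≤ n →
      (bondPercolation (zdGraph 2) half).real (zdFiveArmClusters m₁ n) ≤ C / (n : ℝ) ^ 2)
    (hQ : ∃ c : ℝ, 0 < c ∧ ∀ m n : ℕ, m₁ ≤ m → m ≤ n →
      c * (bondPercolation (zdGraph 2) half).real (zdFiveArmClusters m₁ m) *
          (bondPercolation (zdGraph 2) half).real (zdFiveArmClusters m n) ≤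
        (bondPercolation (zdGraph 2) half).real (zdFiveArmClusters m₁ n))
    (hL : ∃ c' : ℝ, 0 < c' ∧ ∀ m : ℕ, m₁ ≤ m →
      c' / (m : ℝ) ^ 2 ≤ (bondPercolation (zdGraph 2) half).real (zdFiveArmClusters m₁ m)) :
    DuminilCopinManolescuTassion2021_zdFiveArm_upperBound := by
  obtain ⟨C, hU⟩ := hU
  obtain ⟨c, hc, hQ⟩ := hQ
  obtain ⟨c', hc', hL⟩ := hL
  set μ := bondPercolation (zdGraph 2) half with hμ
  have hK0 : 0 ≤ max C 0 / (c * c') := by positivity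
  -- the two-radii bound in the range `m₁ ≤ m ≤ n`
  have key : ∀ m n : ℕ, m₁ ≤ m → m ≤ n →
      μ.real (zdFiveArmClusters m n) ≤ max C 0 / (c * c') * ((m : ℝ) / n) ^ 2 := by
    intro m n hm hmn
    have hm0 : (0 : ℝ) < m := by exact_mod_cast (show 0 < m by omega)
    have hn0 : (0 : ℝ) < n := by exact_mod_cast (show 0 < n by omega)
    have hU' : μ.real (zdFiveArmClusters m₁ n) ≤ max C 0 / (n : ℝ) ^ 2 :=
      (hU n (hm.trans hmn)).trans (div_le_div_of_nonneg_right (le_max_left _ _) (by positivity))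
    have hP0 : 0 ≤ μ.real (zdFiveArmClusters m n) := measureReal_nonneg
    have hkey : c * c' / (m : ℝ) ^ 2 * μ.real (zdFiveArmClusters m n) ≤ max C 0 / (n : ℝ) ^ 2 := by
      calc c * c' / (m : ℝ) ^ 2 * μ.real (zdFiveArmClusters m n)
          = c * (c' / (m : ℝ) ^ 2) * μ.real (zdFiveArmClusters m n) := by ring
        _ ≤ c * μ.real (zdFiveArmClusters m₁ m) * μ.real (zdFiveArmClusters m n) :=
            mul_le_mul_of_nonneg_right (mul_le_mul_of_nonneg_left (hL m hm) hc.le) hP0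
        _ ≤ μ.real (zdFiveArmClusters m₁ n) := hQ m n hm hmn
        _ ≤ max C 0 / (n : ℝ) ^ 2 := hU'
    have hpos : 0 < c * c' / (m : ℝ) ^ 2 := by positivity
    rw [mul_comm] at hkey
    have h1 := (le_div_iff₀ hpos).2 hkey
    refine h1.trans (le_of_eq ?_)
    field_simp
  refine ⟨(max C 0 / (c * c') + 1) * (m₁ : ℝ) ^ 2, by positivity, fun r R hr hrR => ?_⟩
  have hR1 : 1 ≤ R := hr.trans hrR
  have hR0 : (0 : ℝ) < R := by exact_mod_cast (show 0 < R by omega)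
  have hq0 : 0 ≤ ((r : ℝ) / R) ^ 2 := by positivity
  -- the common last step: `A · (r/R)² ≤ (K + 1) m₁² (r/R)²` once `A ≤ (K + 1) m₁²`
  have hfin : ∀ A : ℝ, A ≤ (max C 0 / (c * c') + 1) * (m₁ : ℝ) ^ 2 →
      A * ((r : ℝ) / R) ^ 2 ≤ (max C 0 / (c * c') + 1) * (m₁ : ℝ) ^ 2 * ((r : ℝ) / R) ^ 2 :=
    fun A hA => mul_le_mul_of_nonneg_right hA hq0
  have hm₁1 : (1 : ℝ) ≤ (m₁ : ℝ) ^ 2 := one_le_pow₀ (by exact_mod_cast hm₁)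
  by_cases hRm : R < m₁
  · -- `R < m₁`: the probability is at most `1 ≤ m₁² (r/R)²`
    have hone : (1 : ℝ) ≤ (m₁ : ℝ) * r / R := by
      rw [le_div_iff₀ hR0, one_mul]
      exact_mod_cast (show R ≤ m₁ * r from hRm.le.trans (Nat.le_mul_of_pos_right m₁ hr))
    calc μ.real (zdFiveArmClusters r R) ≤ 1 := measureReal_le_one
      _ ≤ ((m₁ : ℝ) * r / R) ^ 2 := one_le_pow₀ hone
      _ = (m₁ : ℝ) ^ 2 * ((r : ℝ) / R) ^ 2 := by ring
      _ ≤ (max C 0 / (c * c') + 1) * (m₁ : ℝ) ^ 2 * ((r : ℝ) / R) ^ 2 :=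
          hfin _ (le_mul_of_one_le_left (by positivity) (by linarith))
  · push Not at hRm
    by_cases hrm : m₁ ≤ r
    · -- `m₁ ≤ r ≤ R`: the key estimate
      calc μ.real (zdFiveArmClusters r R) ≤ max C 0 / (c * c') * ((r : ℝ) / R) ^ 2 := key r R hrm hrR
        _ ≤ (max C 0 / (c * c') + 1) * (m₁ : ℝ) ^ 2 * ((r : ℝ) / R) ^ 2 := hfin _ (by nlinarith)
    · -- `r < m₁ ≤ R`: shrink the annulus to `A_{m₁,R}`
      push Not at hrm
      have hle : (m₁ : ℝ) / R ≤ (m₁ : ℝ) * r / R :=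
        div_le_div_of_nonneg_right (le_mul_of_one_le_right (by positivity) (by exact_mod_cast hr)) hR0.le
      calc μ.real (zdFiveArmClusters r R) ≤ μ.real (zdFiveArmClusters m₁ R) :=
            real_zdFiveArmClusters_mono half hrm.le hRm le_rfl
        _ ≤ max C 0 / (c * c') * ((m₁ : ℝ) / R) ^ 2 := key m₁ R le_rfl hRm
        _ ≤ max C 0 / (c * c') * (((m₁ : ℝ) * r / R) ^ 2) :=
            mul_le_mul_of_nonneg_left (pow_le_pow_left₀ (by positivity) hle 2) hK0
        _ = max C 0 / (c * c') * (m₁ : ℝ) ^ 2 * ((r : ℝ) / R) ^ 2 := by ring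
        _ ≤ (max C 0 / (c * c') + 1) * (m₁ : ℝ) ^ 2 * ((r : ℝ) / R) ^ 2 := hfin _ (by nlinarith)


end Literature.Probability.Percolation
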